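import Mathlib
import HarnessLib
import HarnessLib.Audit
import Summits.AtomisticToContinuum.Statement
import Literature.MathematicalPhysics.KineticTheory.LangevinChainKernel
import Literature.MathematicalPhysics.KineticTheory.LangevinChainGibbs
import Literature.MathematicalPhysics.KineticTheory.LangevinChainNESS
import Summits.AtomisticToContinuum.FouriersLaw.Theorems.EmbeddedDrudeMourreNessUnique
import HarnessLib.Audit.Status.Attr

/-!
Route: EscapeDeficit

CLOSED (retired) 2026-08-15T13:42:13Z by operator:999:1257524 — reason: not-a-thesis: assembly does not conclude the sub-problem Statement — note: D-0027 §2.1 audit (human 2026-08-15: routes that do not decide the summit are removed): the assembly concludes `Literature.MathematicalPhysics.KineticTheory.HeatConduction.FouriersLaw`, not the sub-problem statement; a NEW conforming route may be opened from the same idea (generated `closes : … → _r. The file is kept as the record of this route; refuted decls are indexed as negative knowledge (`ledger negatives`).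

Route EscapeDeficit — realises idea card
AtomisticToContinuum/FouriersLaw/escape-deficit-boundary-tail ("conductance = zero-frequency noise
depression of the boundary kinetic energy; Fourier's law as a t^(-1/2) / √ω-cusp law").

X_b (BOUNDARY FORM OF FOURIER'S LAW). For P = pinnedChain ω₂ lam β γ (all four > 0) and T > 0 let
  K_N(u) := ∫ (p_0² − T) · P_u^{N,T,T}(p_0² − T) dμ_T^N
be the equilibrium autocorrelation of the boundary kinetic energy b = p_0² of the N-site chain with
BOTH Langevin baths at T (μ_T^N = OscillatorChain.gibbsMeasure P N T, P_u = the CONSTRUCTED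
transition kernel OscillatorChain.transitionKernel P N T T u of LangevinChainKernel.lean), θ_N(t) :=
(γ/T²)∫_0^t K_N(u) du the BOUNDARY THERMALISATION CURVE (= the first-order response of ⟨p_0²⟩_t to a
step δ of the left bath temperature, divided by δ: Gaussian integration by parts ∂_{T_L}L =
γ∂²_{p_0}, ∫∂²_{p_0}f dμ_T = T⁻²∫f(p_0²−T)dμ_T), and E_N := 1 − θ_N(∞) the ESCAPE DEFICIT of the
N-chain. Then
  (R) [response identity] under weak-NESS uniqueness, for every steady-state family the BLR
coefficient D_N(T) = lim_{δ→0} totalCurrent(μ_{N,T+δ/2,T−δ/2})/δ exists and D_N(T) = (N−1)·γ·E_N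
(J̃ = γ(T_L − ⟨p_0²⟩_μ) by energy balance at site 0, linear response, left/right reflection symmetry
of the equilibrium dynamics; checked by hand: dJ̃/dδ = γ/2 − γ(½ − E_N) = γE_N);
  (E) [escape law] (N−1)·γ·E_N → κ_b(T) with 0 < κ_b(T) < ∞.
X_b := (R) ∧ (E). With clause (i) (existence: CuneoEckmannHairerReyBellet2018_pinnedChain, PROVED in
tree; uniqueness: NessUnique, shared with route FourierGreenKubo) X_b ⇒ FouriersLawFor (pinnedChain
ω₂ lam β γ) with κ = κ_b ⇒ FouriersLaw (Assembly, elementary glue).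
The card's mechanism supplies (E) in the second layer, entirely through ONE scalar function of
finite equilibrium chains and its M → ∞ shadow (no infinite-volume dynamics is posited:
"half-infinite" = eventually in the length M of a two-bath chain at equal temperatures):
  HalfChainTailLaw: c/√t ≤ 1 − θ_∞(t) ≤ C/√t for t ≥ t₀ — complete boundary thermalisation of the
half-line (no ballistic channel: the sum rule (γ/T²)∫_0^∞K_∞ = 1, false for the harmonic chain) AT
THE FIRST-RETURN RATE of one-dimensional diffusion (the √|ω| cusp of the boundary noise spectrum);
  DiffusiveCrossover: c₂(1 − θ_∞(a₁N²)) ≤ E_N ≤ C₂(1 − θ_∞(a₀N²)) — the N-chain's deficit (what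
leaves through the far bath instead of returning) is comparable to what the half-line still retains
at times ≍ N²;
  hence c ≤ (N−1)γE_N ≤ C (bounded response AND an Ohmic lower bound), and existence of the limit is
imported as bare non-oscillation of (N−1)γE_N in [−∞, ∞] (EscapeNonOscillation; any
series-law/subadditivity engine supplies it), which keeps BOTH tail bounds load-bearing.
One-line Lean form of the target (decl EscapeLaw): ∀ ω₂ lam β γ > 0, ∀ T > 0, ∃ κb > 0, Tendsto (fun
N : ℕ => ((N:ℝ) − 1) * γ * E N) atTop (𝓝 κb), with E N := 1 − γ/T² * ∫ u in Ioi 0, K N u and K N u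
:= ∫ z, (z.2 0 ^ 2 − T) * (∫ y, (y.2 0 ^ 2 − T) ∂(P.transitionKernel N T T u.toNNReal z))
∂(P.gibbsMeasure N T) (all constants exist: pinnedChain, OscillatorChain.transitionKernel,
OscillatorChain.gibbsMeasure, OscillatorChain.totalCurrent, OscillatorChain.IsSteadyState,
CuneoEckmannHairerReyBellet2018_pinnedChain, FouriersLaw; sketch elaborates rc 0).

Rationale: WHY THIS LINE. BLR's limit takes δT → 0 first, so everything is EQUILIBRIUM dynamics of finite
Langevin chains; the card moves the whole N-dependence onto one scalar time series at the
best-controlled site of the theory (the thermostatted one: OU structure, hypoelliptic smoothing,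
Lyapunov control — Carmona2007, CuneoEckmannHairerReyBellet2018; kernels, Gibbs state, ergodicity
and (2.5) are CONSTRUCTED/PROVED in tree: LangevinChainKernel/Dynkin/Gibbs,
LangevinSemigroupProofs). Imports from probability/potential theory: first-return exponents (∫_t^∞K
≍ t^{-1/2} is the gambler's-ruin tail seen through an absorbing boundary) and parabolic comparison;
the dictionary is an identity, not an analogy: conductance G_N = γE_N = γ²T⁻²∫(K_∞ − K_N)
(KunduDharNarayan2009 open-system response formula + half-line comparison), continuum shadow =
half-space effusivity law and the EMD contact-kernel plateau (BarratChiaruttini2003); stochastic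
shadow proved for SSEP on the half-line with one reservoir (SharmaEtAl2026, DerridaGerschenfeld
lineage). Not chosen: Green–Kubo of the closed infinite chain (route FourierGreenKubo owns it; here
no infinite-volume dynamics and no κ = κ_GK identification is needed), entropy-production bounds
(upper bounds only).
RANKED CRUXES. (2) HalfChainTailLaw — two-sided t^{-1/2} law for 1 − θ_∞(t): the
finiteness-AND-positivity content, N-free. (3) DiffusiveCrossover — E_N comparable to the half-line
retention at times ≍N² (replaces the card's ill-posed "τ_N" statement by a two-sided comparability
with constants; its natural children later: early agreement, late saturation, sign control). (4)
ResponseIdentity — D_N = (N−1)γE_N incl. existence of D_N and K_N ∈ L¹ (fixed-N linear response;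
overlaps FourierGreenKubo.FourierFiniteResponseOfUnique in difficulty, not in statement). (5)
EscapeNonOscillation — IMPORT SLOT: (N−1)γE_N has a limit in [−∞,∞]; lowest rank, expected from the
fekete-resistance-subadditivity card's engine; provers here should not start with it.
SUPPORT. NessUnique (identical signature to FourierGreenKubo's, dedup intended);
BoundaryKernelBasics (Gibbs invariance of the constructed kernels, continuity, |K_N| ≤ 2T²,
exponential decay at fixed N from the proved (2.5) ⇒ K_N ∈ L¹: the warm-up that de-junks θ, E);
HalfChainLocality (θ_∞(t) := lim_M θ_M(t) exists: finite-time locality + 1-D Gibbs marginals; makes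
"half-line" honest, not used by the Assembly); SumRule (θ_∞(t) → 1: the qualitative
no-ballistic-channel milestone ⊂ Tail-upper); EscapeLawOfCruxes (Tail → Crossover → NonOscillation →
EscapeLaw: elementary, doubles as a mesh test of the typed statements).
KILL CRITERIA. (a) ¬SumRule (numerics: S_b(0) ≠ 2T²/γ for a long singly-driven chain, or a proof of
a residual ballistic channel at some lam, β > 0) kills HalfChainTailLaw and physically gives κ = ∞ —
file ¬HalfChainTailLaw and reconsider the conjunct; (b) a boundary cusp exponent ≠ 1/2 (anomalous
scaling 1 − θ_∞ ≍ t^{-α}, α ≠ 1/2) refutes Tail as stated (restate with α only if the conjunct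
survives, which for α < 1/2 it does not); (c) refutation of ResponseIdentity's formula (not mere
non-existence of D_N) means the sign/normalisation bookkeeping is wrong — repairable by restate; (d)
an oscillating (N−1)γE_N refutes only the import slot.
NOT DECOMPOSED YET. The engines for Tail (diffusive spreading bound + maximum principle 0 ≤ θ ≤ 1
for the upper side; conservation + Cauchy–Schwarz for the lower side), the three sub-statements of
Crossover, T-dependence of constants, and any identification κ_b = πγ²A²/c_v (A = tail amplitude) —
deliberately left to splits after a crux moves (D-0019).
SOURCES. BonettoLebowitzReyBellet2000 §5.2–5.3, §6.2–6.3, §7; KunduDharNarayan2009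
(arXiv:0809.4543); ReyBellet2003 Rem 4.4; HairerMajda2009 (arXiv:0909.4313);
CuneoEckmannHairerReyBellet2018 Thm 2.13; Carmona2007; RiederLebowitzLieb1967; Nakazawa1970;
LepriLiviPoliti2003 §5, §8; Dhar2008 §5; BarratChiaruttini2003; ButtaEtAl2007; BeckerMenegaki2022;
CanestrariLiveraniOlla2026; SharmaEtAl2026 (arXiv:2405.00654); arXiv:2510.20003.

Novelty: Searches: the card's two refuter audits (crossref ×4, zbMATH, galaxy all/pdf; `lit read`
arXiv:0809.4543, doi:10.1080/0026897031000068578 p.6) plus at open `lit frontier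
AtomisticToContinuum --since 2020` (only half-line items: SSEP with one reservoir arXiv:2405.00654 =
SharmaEtAl2026; tagged particle on a half-infinite HARMONIC chain arXiv:2510.20003) and `lit search
--hybrid "semi-infinite chain single heat bath boundary temperature relaxation power law
anharmonic"` (engineering books only). Nearest prior art: KunduDharNarayan2009 (open-system
Green–Kubo: response = ∫⟨J J_fp⟩, J_fp = −(γ/2)(v_1² − T) — the identity D_N = (N−1)γE_N in
substance); BarratChiaruttini2003 (EMD contact conductance = T⁻²∫⟨q q(t)⟩ with finite-size
plateau-then-decay; deficit-over-a-window folklore); the half-space effusivity law; SharmaEtAl2026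
(stochastic half-line, one reservoir). Delta: (1) escape-deficit comparison N-chain vs half-line for
the BLR Hamiltonian chain, typed WITHOUT infinite-volume dynamics (eventually-in-M over the
constructed finite-chain kernels); (2) Fourier's law for all N reduced to a two-sided first-return
law for ONE boundary scalar + a two-sided crossover comparability (the card's ill-posed τ_N
statement repaired), limit-existence isolated as bare non-oscillation so both tail bounds stay
load-bearing; (3) response identity for BLR's symmetric driving (reflection symmetry removes the
cross-kernel). Grade claimed: new-combination (audited twice; no new engine).  [refs: 10.1080/0026897031000068578, 0809.4543, 2405.00654, 2510.20003, doi:10.1080/0026897031000068578, SharmaEtAl2026, KunduDharNarayan2009, BarratChiaruttini2003]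

Barriers (technique_class: boundary-tail half-line-comparison fixed-N-linear-response): technique_class: boundary-tail half-line-comparison fixed-N-linear-response (long form:
boundary-autocorrelation-tail of one thermostatted site; half-infinite comparison realised
eventually-in-M; escape-deficit identity; fixed-N linear response for the identity only; the
analytic cruxes are hydrodynamic-scale statements)
- Literature.Barriers.AtomisticToContinuum.HasBoundedResponse: APPLIES to ResponseIdentity, which is
fixed-N linear response (inside the class) and is used only at fixed N; the N-dependence is exported
to the N-free curve θ_∞ (HalfChainTailLaw) plus DiffusiveCrossover, which are NOT fixed-N statements
— the barrier is met head-on by those two cruxes, not evaded; bounded response is an OUTPUT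
(Tail-upper + Crossover-upper), cf. hasBoundedResponse_of_fouriersLawFor.
- Literature.Barriers.AtomisticToContinuum.MacroErgodicityBarrier: Tail and Crossover are
hydrodynamic-scale statements and stand at the same wall as every diffusive argument; no
one-block/two-block estimate is formulated — the bet is that a ONE-boundary, time-integrated,
first-order quantity at a thermostatted site (where hypoellipticity, the OU structure and the proved
exponential ergodicity at fixed N are strongest) needs less than bulk local equilibrium (comparison
principles for 0 ≤ θ ≤ 1 replace block estimates). Honest: re-localised, not evaded.
- Literature.Barriers.AtomisticToContinuum.HarmonicChainBallisticFlux: at lam = β = 0 the sum rule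
is DEFICIENT (θ_∞(∞) < 1, permanent inflow into a

Novelty grade: new-combination — Refuter route-review gen-1 (4400e3b7), 2026-08-15. new-combination = (A) open-system Green–Kubo / boundary response identity — conductance from the equilibrium autocorrelation of the thermostatted site (Kundu–Dhar–Narayan 2009; BLR 2000 §5.2 bookkeeping), re-derived by hand here: θ^{0,R} = E_N via t (refuter refuter-rreview-route-AnomalousDissipati-4400e3b7-0, 2026-08-15T13:58:05Z; prior: arXiv:0809.4543 (Kundu–Dhar–Narayan 2009 open-system Green–Kubo / boundary response), BonettoLebowitzReyBellet2000 §5.2–5.3 (current bookkeeping, statement (33)), doi:10.1080/0026897031000068578 (Barrat–Chiaruttini 2003 EMD contact kernel plateau), arXiv:2405.00654 (Sharma et al. 2026, SSEP half-line with one reservoir), arXiv:2510.20003 (tagged particle, half-infinite harmonic chain), RiederLebow)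

History (route lifecycle, newest last):
- 2026-08-15T13:42:13Z · CLOSED retired — not-a-thesis: assembly does not conclude the sub-problem Statement (operator:999:1257524)

sub-problem: FouriersLaw · status: closed(retired) · opened planner-plancard-AtomisticToContinuum-Fourier-bc4d78e9-0 2026-08-15T11:09:42Z · rev 0 · ledger route-AtomisticToContinuum-EscapeDeficit
GENERATED by the gate from the ledger (D-0016/17). Provers cite these decls: `theorem foo : Summit.AtomisticToContinuum.FouriersLaw.Theses.EscapeDeficit.<Decl> := …` in Summits/AtomisticToContinuum/FouriersLaw/Theorems/<Name>.lean.
-/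

namespace Summit.AtomisticToContinuum.FouriersLaw.Theses.EscapeDeficit

open scoped BigOperators Topology Manifold Classical MeasureTheory ProbabilityTheory Matrix InnerProductSpace ComplexConjugate ContinuousMap
open Filter Set Function TopologicalSpace MeasureTheory

attribute [summit_statement] _root_.FouriersLaw

/-- item stmt-AtomisticToContinuum-2947 · target · rank 0 · closed · moot by None · by planner
why it might fail: Inherits Tail, Crossover and the non-oscillation import; κ_b > 0 finite is exactly normal conduction of the pinned anharmonic chain, open for every deterministic anharmonic bulk (BLR2000).
sources: BonettoLebowitzReyBellet2000 §1, §5.3 (33), KunduDharNarayan2009 (arXiv:0809.4543)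
[target] THE ESCAPE LAW X_b(E): for all parameters > 0 and T > 0 there is κ_b(T) > 0 with
(N−1)·γ·E_N → κ_b(T) — Fourier's law for the whole sequence of chains as a 1/N law for the escape
deficit of ONE boundary observable of equilibrium finite chains ('the conductance is what fails to
come back'). Notation (see thesis): K N u = equilibrium autocorrelation of p_0² − T, N-site chain,
both baths at T, constructed kernels + gibbsMeasure; θ N t = (γ/T²)∫_0^t K N; E N = 1 − (γ/T²)∫_0^∞
K N (escape deficit); half-line = `∀ᶠ M in atTop`. Follows elementarily from HalfChainTailLaw +
DiffusiveCrossover + EscapeNonOscillation (support item EscapeLawOfCruxes); together with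
CuneoEckmannHairerReyBellet2018_pinnedChain (proved), NessUnique and ResponseIdentity it gives
FouriersLaw with κ = κ_b (Assembly). Physically κ_b = κ and, if the tail is sharp (1 − θ_∞(t) ~ A
t^{-1/2}), κ = πγ²A²/c_v(T) (not claimed). -/
@[route_item "route-AtomisticToContinuum-EscapeDeficit"]
def EscapeLaw : Prop :=
  ∀ ω₂ lam β γ : ℝ, 0 < ω₂ → 0 < lam → 0 < β → 0 < γ → ∀ T : ℝ, 0 < T → (let P := Literature.MathematicalPhysics.KineticTheory.HeatConduction.pinnedChain ω₂ lam β γ; let K : ℕ → ℝ → ℝ := fun N u => if h : 0 < N then ∫ z, ((z.2 ⟨0, h⟩) ^ 2 - T) * (∫ y, ((y.2 ⟨0, h⟩) ^ 2 - T) ∂(P.transitionKernel N T T u.toNNReal z)) ∂(P.gibbsMeasure N T) else 0; let E : ℕ → ℝ := fun N => 1 - γ / T ^ 2 * ∫ u in Set.Ioi (0 : ℝ), K N u; ∃ κb : ℝ, 0 < κb ∧ Filter.Tendsto (fun N : ℕ => ((N : ℝ) - 1) * γ * E N) Filter.atTop (nhds κb))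

/-- item stmt-AtomisticToContinuum-2943 · crux · rank 2 · closed · moot by None · by planner
why it might fail: Two-sided diffusive law for one boundary scalar of a Hamiltonian half-line at all T>0: upper = diffusive spreading bound (exists for no anharmonic chain, BLR2000 §6.3), lower = no superdiffusive escape; as T→0 the chain is near-harmonic (θ_∞(∞)<1, RLL): c,C,t₀ degenerate; breathers may trap energy.
sources: BonettoLebowitzReyBellet2000 §6.2-6.3, RiederLebowitzLieb1967, Nakazawa1970, LepriLiviPoliti2003 §5, §8, Dhar2008 §5, arXiv:2510.20003
[crux] HALF-LINE BOUNDARY TAIL LAW (card: TAIL). Notation (see thesis): K N u = equilibrium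
autocorrelation of p_0² − T, N-site chain, both baths at T, constructed kernels + gibbsMeasure; θ N
t = (γ/T²)∫_0^t K N; E N = 1 − (γ/T²)∫_0^∞ K N (escape deficit); half-line = `∀ᶠ M in atTop`. Claim:
∃ c, C, t₀ > 0: for every t ≥ t₀, eventually in the length M, c/√t ≤ 1 − θ_M(t) ≤ C/√t. Reading: 1 −
θ_∞(t) = J(t)/(γδ) is the normalised energy inflow still entering a half-infinite chain a time t
after its single bath was raised by δ. Upper bound = complete boundary thermalisation (sum rule
(γ/T²)∫_0^∞K_∞ = 1: no ballistic channel — FALSE for the harmonic chain,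
RiederLebowitzLieb1967/Nakazawa1970) at no slower than the diffusive rate; lower bound = energy not
carried away faster than diffusively (first-return exponent of 1-D diffusion through an absorbing
boundary; frequency form: √|ω| cusp of the power spectrum of b at 0, S_b(0) = 2T²/γ). Shadows: Robin
half-space 1 − θ(0,t) ≈ √(κc_v/π)/(γ√t); SSEP half-line with one reservoir (SharmaEtAl2026). Engines
foreseen: spreading bound + maximum principle 0 ≤ θ ≤ 1 (upper); conservation + Cauchy–Schwarz
(lower). Later split: TailUpper/TailLower. -/
@[route_item "route-AtomisticToContinuum-EscapeDeficit", crux]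
def HalfChainTailLaw : Prop :=
  ∀ ω₂ lam β γ : ℝ, 0 < ω₂ → 0 < lam → 0 < β → 0 < γ → ∀ T : ℝ, 0 < T → (let P := Literature.MathematicalPhysics.KineticTheory.HeatConduction.pinnedChain ω₂ lam β γ; let K : ℕ → ℝ → ℝ := fun N u => if h : 0 < N then ∫ z, ((z.2 ⟨0, h⟩) ^ 2 - T) * (∫ y, ((y.2 ⟨0, h⟩) ^ 2 - T) ∂(P.transitionKernel N T T u.toNNReal z)) ∂(P.gibbsMeasure N T) else 0; let θ : ℕ → ℝ → ℝ := fun N t => γ / T ^ 2 * ∫ u in (0 : ℝ)..t, K N u; ∃ c C t₀ : ℝ, 0 < c ∧ 0 < t₀ ∧ ∀ t : ℝ, t₀ ≤ t → ∀ᶠ M : ℕ in Filter.atTop, c / Real.sqrt t ≤ 1 - θ M t ∧ 1 - θ M t ≤ C / Real.sqrt t)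

/-- item stmt-AtomisticToContinuum-2944 · crux · rank 3 · closed · moot by None · by planner
why it might fail: Compares the two-bath N-chain with the half-line at times ~N²: needs the far bath invisible at site 0 before the diffusive time to O(1/N), saturation after it (decay rate ≳1/N² of ONE autocorrelation; harmonic L²-gap is N⁻³, Becker–Menegaki) and sign control of K_N at kinetic times.
sources: BeckerMenegaki2022 Thm 1, KunduDharNarayan2009 (arXiv:0809.4543), BarratChiaruttini2003 p.6 (finite-size plateau of the contact kernel), BonettoLebowitzReyBellet2000 §5.3, ButtaEtAl2007 (propagation bounds, quartic chain), Dhar2008 §2.2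
[crux] DIFFUSIVE CROSSOVER (card: CROSSOVER, made well-posed). Notation (see thesis): K N u =
equilibrium autocorrelation of p_0² − T, N-site chain, both baths at T, constructed kernels +
gibbsMeasure; θ N t = (γ/T²)∫_0^t K N; E N = 1 − (γ/T²)∫_0^∞ K N (escape deficit); half-line = `∀ᶠ M
in atTop`. Claim: ∃ a₀, a₁, c₂ > 0, C₂: for all large N, eventually in M, c₂(1 − θ_M(a₁N²)) ≤ E_N ≤
C₂(1 − θ_M(a₀N²)). Reading: by the sum rule E_N = (γ/T²)∫_0^∞(K_∞ − K_N) is the part of a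
spontaneous boundary energy fluctuation that, in the N-chain, leaves through the FAR bath instead of
returning; the claim: it is comparable to what the half-line still retains at times ≍ N² (the card's
τ_N ≍ N²; τ_N was left free). With HalfChainTailLaw at t = a_iN²: c ≤ N·E_N ≤ C, i.e. bounded
response AND an Ohmic lower bound. Foreseen children (≤ 3): EARLY AGREEMENT |θ_∞ − θ_N|(a₀N²) =
o(1/N) (far bath invisible at site 0 before the diffusive time — hydrodynamic beyond the light cone
N/v), LATE SATURATION N√a|θ_N(∞) − θ_N(aN²)| → 0 as a → ∞, SIGNS (θ_N(∞) ≥ θ_N(a₀N²) − o(1/N); θ_N ≤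
θ_∞ + o(1/N) at a₁N²: an absorbing far bath never makes the near boundary thermalise MORE). -/
@[route_item "route-AtomisticToContinuum-EscapeDeficit"]
def DiffusiveCrossover : Prop :=
  ∀ ω₂ lam β γ : ℝ, 0 < ω₂ → 0 < lam → 0 < β → 0 < γ → ∀ T : ℝ, 0 < T → (let P := Literature.MathematicalPhysics.KineticTheory.HeatConduction.pinnedChain ω₂ lam β γ; let K : ℕ → ℝ → ℝ := fun N u => if h : 0 < N then ∫ z, ((z.2 ⟨0, h⟩) ^ 2 - T) * (∫ y, ((y.2 ⟨0, h⟩) ^ 2 - T) ∂(P.transitionKernel N T T u.toNNReal z)) ∂(P.gibbsMeasure N T) else 0; let θ : ℕ → ℝ → ℝ := fun N t => γ / T ^ 2 * ∫ u in (0 : ℝ)..t, K N u; let E : ℕ → ℝ := fun N => 1 - γ / T ^ 2 * ∫ u in Set.Ioi (0 : ℝ), K N u; ∃ a₀ a₁ c₂ C₂ : ℝ, 0 < a₀ ∧ 0 < a₁ ∧ 0 < c₂ ∧ ∀ᶠ N : ℕ in Filter.atTop, ∀ᶠ M : ℕ in Filter.atTop, c₂ * (1 - θ M (a₁ * (N :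 ℝ) ^ 2)) ≤ E N ∧ E N ≤ C₂ * (1 - θ M (a₀ * (N : ℝ) ^ 2)))

/-- item stmt-AtomisticToContinuum-2945 · crux · rank 4 · closed · moot by None · by planner
why it might fail: Finite-N linear response at equilibrium (δ-differentiability of the NESS current) is unproved for the Langevin pinned chain (Hairer–Majda Assumption 5 fails; FGK item 0717 open); also needs Gibbs = invariant law of the constructed kernels, J̃=γ(T_L−⟨p_0²⟩) in the weak class, reflection symmetry.
sources: KunduDharNarayan2009 (arXiv:0809.4543) p.3, ReyBellet2003 Rem 4.4 (56), HairerMajda2009 (arXiv:0909.4313) Thm 2.3, BonettoLebowitzReyBellet2000 §5.2 (23)-(27), (32), CuneoEckmannHairerReyBellet2018 Thm 2.13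
[crux] RESPONSE IDENTITY D_N = (N−1)·γ·E_N (card: ResponseIdentities). Notation (see thesis): K N u
= equilibrium autocorrelation of p_0² − T, N-site chain, both baths at T, constructed kernels +
gibbsMeasure; θ N t = (γ/T²)∫_0^t K N; E N = 1 − (γ/T²)∫_0^∞ K N (escape deficit); half-line = `∀ᶠ M
in atTop`. Claim: parameters > 0; ASSUMING uniqueness of weak steady states (hypothesis =
NessUnique): for every steady-state family μ, T > 0, N ≥ 1, K_N ∈ L¹(0,∞) and totalCurrent(μ N
(T+δ/2) (T−δ/2))/δ → (N−1)γE_N as δ → 0, δ ≠ 0 (existence AND value; N = 1: both sides 0).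
Derivation (checked by hand, see thesis): totalCurrent = (N−1)J̃; J̃ = γ(T_L − ⟨p_0²⟩_μ) (energy
balance at site 0); response of ⟨p_0²⟩ by Gaussian integration by parts ∂_{T_b}L = γ∂²_{p_b},
∫∂²_{p_b}f dμ_T = T⁻²∫f(p_b² − T)dμ_T; for the symmetric driving the cross kernel K^{N−1,0} drops
out by left/right reflection symmetry (U, V even) and J̃ = γ(⟨p_{N−1}²⟩ − T_R): dJ̃/dδ = γE_N. Real
content: finite-N linear response at equilibrium for the hypoelliptic chain (cf.
FourierGreenKubo.FourierFiniteResponseOfUnique); Gibbs invariance of the constructed kernels;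
stationarity on polynomials; K_N ∈ L¹ from the PROVED (2.5). -/
@[route_item "route-AtomisticToContinuum-EscapeDeficit", crux]
def ResponseIdentity : Prop :=
  ∀ ω₂ lam β γ : ℝ, 0 < ω₂ → 0 < lam → 0 < β → 0 < γ → (∀ (N : ℕ) (T_L T_R : ℝ), 0 < T_L → 0 < T_R → ∀ μ ν : MeasureTheory.Measure (Literature.MathematicalPhysics.KineticTheory.HeatConduction.PhaseSpace N), (Literature.MathematicalPhysics.KineticTheory.HeatConduction.pinnedChain ω₂ lam β γ).IsSteadyState N T_L T_R μ → (Literature.MathematicalPhysics.KineticTheory.HeatConduction.pinnedChain ω₂ lam β γ).IsSteadyState N T_L T_R ν → μ = ν) → ∀ μ : (N : ℕ) → ℝ → ℝ → MeasureTheory.Measure (Literature.MathematicalPhysics.KineticTheory.HeatConduction.PhaseSpace N), (∀ (N : ℕ) (T_L T_R : ℝ), 0 < T_L → 0 < T_R → (Literature.MathematicalPhysics.KineticTheory.HeatConduction.pinnedChain ω₂ lam β γ).IsSteadyState N T_L T_R (μ N T_L T_R)) → ∀ T : ℝ, 0 < T → (let P := Literature.MathematicalPhysics.KineticTheory.HeatConduction.pinnedChain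 ω₂ lam β γ; let K : ℕ → ℝ → ℝ := fun N u => if h : 0 < N then ∫ z, ((z.2 ⟨0, h⟩) ^ 2 - T) * (∫ y, ((y.2 ⟨0, h⟩) ^ 2 - T) ∂(P.transitionKernel N T T u.toNNReal z)) ∂(P.gibbsMeasure N T) else 0; let E : ℕ → ℝ := fun N => 1 - γ / T ^ 2 * ∫ u in Set.Ioi (0 : ℝ), K N u; ∀ N : ℕ, 0 < N → MeasureTheory.IntegrableOn (K N) (Set.Ioi 0) ∧ Filter.Tendsto (fun δ : ℝ => P.totalCurrent (μ N (T + δ / 2) (T - δ / 2)) / δ) (nhdsWithin 0 {(0 : ℝ)}ᶜ) (nhds (((N : ℝ) - 1) * γ * E N)))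

/-- item stmt-AtomisticToContinuum-2946 · crux · rank 5 · closed · moot by None · by planner
why it might fail: Bare regularity of N↦(N−1)γE_N (liminf = limsup in [−∞,∞]); expected from resistance quasi-subadditivity (fekete card) or monotone saturation, neither proved; parity/commensurability oscillations of the conductance in N (low T, near-integrable corner) would refute it, the Ohmic bracket surviving.
sources: BonettoLebowitzReyBellet2000 §5.3 (33), CanestrariLiveraniOlla2026 §1 (arXiv:2310.13338), idea card AtomisticToContinuum/FouriersLaw/fekete-resistance-subadditivity
[crux — IMPORT SLOT, lowest rank] NON-OSCILLATION OF THE ESCAPE DEFICIT. Notation (see thesis): K N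
u = equilibrium autocorrelation of p_0² − T, N-site chain, both baths at T, constructed kernels +
gibbsMeasure; θ N t = (γ/T²)∫_0^t K N; E N = 1 − (γ/T²)∫_0^∞ K N (escape deficit); half-line = `∀ᶠ M
in atTop`. Claim: the real sequence (N−1)·γ·E_N has a limit in EReal = [−∞, ∞] (liminf = limsup; no
value is claimed). This is the minimal 'existence of the limit' ingredient of BLR (33) that the
boundary mechanism does not produce by itself (Tail + Crossover give only c ≤ (N−1)γE_N ≤ C); stated
in EReal so that BOTH halves of the bracket stay load-bearing (for the harmonic chain it holds with
limit ⊤ while Tail-upper fails). Expected engines live in other cards: quasi-subadditivity of the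
resistance 1/(γE_N) (fekete-resistance-subadditivity: gives lim in (0,∞] by Fekete), or monotone
saturation of N ↦ N·E_N; a route realising one of them should supersede this item (dedup by
signature will not catch it — planner to re-point the Assembly then). Provers of THIS route should
not start here. -/
@[route_item "route-AtomisticToContinuum-EscapeDeficit"]
def EscapeNonOscillation : Prop :=
  ∀ ω₂ lam β γ : ℝ, 0 < ω₂ → 0 < lam → 0 < β → 0 < γ → ∀ T : ℝ, 0 < T → (let P := Literature.MathematicalPhysics.KineticTheory.HeatConduction.pinnedChain ω₂ lam β γ; let K : ℕ → ℝ → ℝ := fun N u => if h : 0 < N then ∫ z, ((z.2 ⟨0, h⟩) ^ 2 - T) * (∫ y, ((y.2 ⟨0, h⟩) ^ 2 - T) ∂(P.transitionKernel N T T u.toNNReal z)) ∂(P.gibbsMeasure N T) else 0; let E : ℕ → ℝ := fun N => 1 - γ / T ^ 2 * ∫ u in Set.Ioi (0 : ℝ), K N u; ∃ ℓ : EReal, Filter.Tendsto (fun N : ℕ => ((((N : ℝ) - 1) * γ * E N : ℝ) : EReal)) Filter.atTop (nhds ℓ))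

/-- item stmt-AtomisticToContinuum-0741 · support · rank 9 · closed · proved by Summit.AtomisticToContinuum.FouriersLaw.Theorems.nessUnique_proof (prover) · by planner
sources: CuneoEckmannHairerReyBellet2018 Thm 2.13
[crux] UNIQUENESS OF THE WEAK STEADY STATE (the half of stmt-0706 not covered by the landed fact
Literature.MathematicalPhysics.KineticTheory.HeatConduction.CuneoEckmannHairerReyBellet2018_pinnedChain,
p3544): for pinnedChain ω₂ lam β γ (all > 0), every N and T_L, T_R > 0, any two measures in the weak
Fokker–Planck class IsSteadyState (probability, ∫ L f dμ = 0 for f ∈ C_c^∞, bond currents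
integrable) coincide. Print: uniqueness of the INVARIANT MEASURE of the Langevin semigroup
(CuneoEckmannHairerReyBellet2018 Thm 2.13(1): C1, C2, CA; Carmona2007 Thm 1.1(iii)); the item
additionally needs 'weak stationary probability solution of L*μ = 0 ⇒ P_t-invariant' for this
hypoelliptic L with cubic drift (Echeverría 1982 well-posed martingale problem on C_c^∞ +
non-explosion via e^{θH}; Bogachev–Krylov–Röckner–Shaposhnikov 2015 Ch. 5 is non-degenerate only) —
the FP-identification lemma is the formal crux. N = 0: PhaseSpace 0 is a point (unique probability
measure); N = 1: both baths on site 0, OU at temperature (T_L+T_R)/2. This is exactly the hypothesis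
of FiniteResponse and ThermodynamicLimit and, with the fact, gives clause (i) of FouriersLawFor. -/
@[route_item "route-AtomisticToContinuum-EscapeDeficit", crux]
def NessUnique : Prop :=
  ∀ ω₂ lam β γ : ℝ, 0 < ω₂ → 0 < lam → 0 < β → 0 < γ → ∀ (N : ℕ) (T_L T_R : ℝ), 0 < T_L → 0 < T_R → ∀ μ ν : MeasureTheory.Measure (Literature.MathematicalPhysics.KineticTheory.HeatConduction.PhaseSpace N), (Literature.MathematicalPhysics.KineticTheory.HeatConduction.pinnedChain ω₂ lam β γ).IsSteadyState N T_L T_R μ → (Literature.MathematicalPhysics.KineticTheory.HeatConduction.pinnedChain ω₂ lam β γ).IsSteadyState N T_L T_R ν → μ = ν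

/-- item stmt-AtomisticToContinuum-2949 · support · rank 9 · closed · moot by None · by planner
sources: CuneoEckmannHairerReyBellet2018 §3.1, Thm 2.13 (2.5)
[support, warm-up that de-junks θ and E] BASICS OF THE BOUNDARY KERNEL at fixed N ≥ 1, T > 0,
parameters > 0: (a) the Gibbs measure is INVARIANT for the constructed transition kernels at equal
bath temperatures, (gibbsMeasure N T).bind (transitionKernel N T T t) = gibbsMeasure N T (CEHR §3.1
'well known: L*e^{−βH} = 0'; in tree: weak stationarity pinnedChain_isSteadyState_gibbsMeasure is
proved, invariance for the kernels is not — Dynkin + uniqueness for the forward equation, or Itô on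
the pathwise solution); (b) u ↦ K N u is continuous (Feller + dominated convergence via (3.4)); (c)
|K N u| ≤ 2T² = Var_{μ_T}(p_0²) (P_u contracts L²(μ_T) once (a) holds); (d) |K N u| ≤ C e^{−cu} from
the PROVED exponential convergence (2.5) (pinnedChainSemigroup_ergodic; Gibbs = μ⋆ by (a) +
uniqueness); (e) hence K N ∈ L¹(0,∞). Notation (see thesis): K N u = equilibrium autocorrelation of
p_0² − T, N-site chain, both baths at T, constructed kernels + gibbsMeasure; θ N t = (γ/T²)∫_0^t K
N; E N = 1 − (γ/T²)∫_0^∞ K N (escape deficit); half-line = `∀ᶠ M in atTop`. -/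
@[route_item "route-AtomisticToContinuum-EscapeDeficit"]
def BoundaryKernelBasics : Prop :=
  ∀ ω₂ lam β γ : ℝ, 0 < ω₂ → 0 < lam → 0 < β → 0 < γ → ∀ T : ℝ, 0 < T → ∀ N : ℕ, 0 < N → (let P := Literature.MathematicalPhysics.KineticTheory.HeatConduction.pinnedChain ω₂ lam β γ; let K : ℕ → ℝ → ℝ := fun N u => if h : 0 < N then ∫ z, ((z.2 ⟨0, h⟩) ^ 2 - T) * (∫ y, ((y.2 ⟨0, h⟩) ^ 2 - T) ∂(P.transitionKernel N T T u.toNNReal z)) ∂(P.gibbsMeasure N T) else 0; (∀ t : NNReal, (P.gibbsMeasure N T).bind (P.transitionKernel N T T t) = P.gibbsMeasure N T) ∧ Continuous (K N) ∧ (∀ u : ℝ, |K N u| ≤ 2 * T ^ 2) ∧ (∃ C c : ℝ, 0 < c ∧ ∀ u : ℝ, 0 ≤ u → |K N u| ≤ C * Real.exp (-c * u)) ∧ MeasureTheory.IntegrableOn (K N) (Set.Ioi 0))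

/-- item stmt-AtomisticToContinuum-2950 · support · rank 9 · closed · moot by None · by planner
sources: ButtaEtAl2007, LanfordLebowitzLieb1977
[support] EXISTENCE OF THE HALF-LINE BOUNDARY CURVE θ_∞(t) := lim_{M→∞} θ_M(t) for every t ≥ 0
(makes 'half-infinite chain with one bath' an honest object; NOT used by the Assembly, whose cruxes
are stated eventually-in-M). Content: finite-time locality of the Langevin/Hamiltonian dynamics with
quartic forces (influence of sites ≥ M on site 0 during [0,t] → 0;
Marchioro–Pellegrinotti–Pulvirenti type bounds, ButtaEtAl2007) + convergence of the 1-D Gibbs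
marginals near site 0 as M → ∞ (transfer operator gap) + |K_M| ≤ 2T² for dominated convergence in u.
Notation (see thesis): K N u = equilibrium autocorrelation of p_0² − T, N-site chain, both baths at
T, constructed kernels + gibbsMeasure; θ N t = (γ/T²)∫_0^t K N; E N = 1 − (γ/T²)∫_0^∞ K N (escape
deficit); half-line = `∀ᶠ M in atTop`. -/
@[route_item "route-AtomisticToContinuum-EscapeDeficit"]
def HalfChainLocality : Prop :=
  ∀ ω₂ lam β γ : ℝ, 0 < ω₂ → 0 < lam → 0 < β → 0 < γ → ∀ T : ℝ, 0 < T → (let P := Literature.MathematicalPhysics.KineticTheory.HeatConduction.pinnedChain ω₂ lam β γ; let K : ℕ → ℝ → ℝ := fun N u => if h : 0 < N then ∫ z, ((z.2 ⟨0, h⟩) ^ 2 - T) * (∫ y, ((y.2 ⟨0, h⟩) ^ 2 - T) ∂(P.transitionKernel N T T u.toNNReal z)) ∂(P.gibbsMeasure N T) else 0; let θ : ℕ → ℝ → ℝ := fun N t => γ / T ^ 2 * ∫ u in (0 : ℝ)..t, K N u; ∀ t : ℝ, 0 ≤ t → ∃ θinf : ℝ, Filter.Tendsto (fun M : ℕ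 => θ M t) Filter.atTop (nhds θinf))

/-- item stmt-AtomisticToContinuum-2951 · support · rank 9 · closed · moot by None · by planner
sources: RiederLebowitzLieb1967, Nakazawa1970, Mazur1969, LepriLiviPoliti2003 §8
[support, milestone ⊂ HalfChainTailLaw(upper); the route's CHEAPEST KILL TEST] SUM RULE / complete
boundary thermalisation of the half-line: ∀ ε > 0 ∃ t₀ ∀ t ≥ t₀, eventually in M, |1 − θ_M(t)| ≤ ε,
i.e. lim_t lim_M θ_M(t) = 1 = (γ/T²)∫_0^∞ K_∞: a half-infinite chain whose single bath is raised by
δ eventually shows ⟨p_0²⟩ = T + δ to first order (energy inflow J(t) → 0) ⇔ no ballistic channel.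
FALSE for the harmonic chain (permanent inflow into a perfect phonon sink: θ_∞(∞) < 1, the orders
lim_t, lim_M do not commute), so lam, β > 0 must enter here. Numerical test from the card: one long
equilibrium run (N = 4096, T = 1, lam = β = 1), check S_b(0) = 2T²/γ for b = p_0². Notation (see
thesis): K N u = equilibrium autocorrelation of p_0² − T, N-site chain, both baths at T, constructed
kernels + gibbsMeasure; θ N t = (γ/T²)∫_0^t K N; E N = 1 − (γ/T²)∫_0^∞ K N (escape deficit);
half-line = `∀ᶠ M in atTop`. -/
@[route_item "route-AtomisticToContinuum-EscapeDeficit"]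
def SumRule : Prop :=
  ∀ ω₂ lam β γ : ℝ, 0 < ω₂ → 0 < lam → 0 < β → 0 < γ → ∀ T : ℝ, 0 < T → (let P := Literature.MathematicalPhysics.KineticTheory.HeatConduction.pinnedChain ω₂ lam β γ; let K : ℕ → ℝ → ℝ := fun N u => if h : 0 < N then ∫ z, ((z.2 ⟨0, h⟩) ^ 2 - T) * (∫ y, ((y.2 ⟨0, h⟩) ^ 2 - T) ∂(P.transitionKernel N T T u.toNNReal z)) ∂(P.gibbsMeasure N T) else 0; let θ : ℕ → ℝ → ℝ := fun N t => γ / T ^ 2 * ∫ u in (0 : ℝ)..t, K N u; ∀ ε : ℝ, 0 < ε → ∃ t₀ : ℝ, ∀ t : ℝ, t₀ ≤ t → ∀ᶠ M : ℕ in Filter.atTop, |1 - θ M t| ≤ ε)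

/-- item stmt-AtomisticToContinuum-2952 · support · rank 9 · closed · moot by None · by planner
sources: BonettoLebowitzReyBellet2000 §5.3
[support, glue of the second layer; also a MESH TEST of the typed statements] the three analytic
cruxes imply the target: bracket c ≤ (N−1)γE_N ≤ C for large N from Tail at t = a₁N², a₀N² and
Crossover (intersect the `∀ᶠ M` filters and pick a witness M), then the EReal limit is a positive
real. Elementary (filters + EReal.tendsto_coe); if it does not go through, the planner mis-typed a
quantifier — report via a note on the route. -/
@[route_item "route-AtomisticToContinuum-EscapeDeficit"]
def EscapeLawOfCruxes : Prop :=
  HalfChainTailLaw → DiffusiveCrossover → EscapeNonOscillation → EscapeLaw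

/-- item stmt-AtomisticToContinuum-2948 · assembly · rank 1 · closed · moot by None · by planner
sources: BonettoLebowitzReyBellet2000 §5.3 (33)
[assembly] CuneoEckmannHairerReyBellet2018_pinnedChain (weak steady state exists for N ≥ 1; PROVED
in tree, LangevinChainNESSHolds) → NessUnique → ResponseIdentity → HalfChainTailLaw →
DiffusiveCrossover → EscapeNonOscillation → FouriersLaw. Glue (elementary, ~80 lines): fix
parameters; clause (i) from the fact (N ≥ 1) / OscillatorChain.isSteadyState_zero (N = 0) +
NessUnique. For T > 0: Tail at t = a₁N², a₀N² and Crossover give, for all large N (pick M in the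
intersection of the three `∀ᶠ M` sets), γc₂c/√a₁ · (N−1)/N ≤ (N−1)γE_N ≤ γC₂C/√a₀; with the EReal
limit ℓ of EscapeNonOscillation, ℓ is real and ≥ γc₂c/√a₁ > 0 (closed-interval argument,
EReal.tendsto_coe), call it κ_b(T); set κ T := κ_b(T) for T > 0, 1 otherwise. For a steady-state
family μ: D 0 := 0 (totalCurrent_zero), D N := (N−1)γE_N for N ≥ 1 (ResponseIdentity gives the
δ-limits), and D → κ T by the above (shift N ↦ N+1). The `let`-bound K, E are syntactically
identical across decls. -/
@[route_item "route-AtomisticToContinuum-EscapeDeficit"]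
def Assembly : Prop :=
  Literature.MathematicalPhysics.KineticTheory.HeatConduction.CuneoEckmannHairerReyBellet2018_pinnedChain → NessUnique → ResponseIdentity → HalfChainTailLaw → DiffusiveCrossover → EscapeNonOscillation → Literature.MathematicalPhysics.KineticTheory.HeatConduction.FouriersLaw

end Summit.AtomisticToContinuum.FouriersLaw.Theses.EscapeDeficit
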